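import Mathlib
import HarnessLib
import Literature.Analysis.FluidPDE.TaoEnstrophyLocalisation
import Literature.Analysis.FluidPDE.HelicityDensityTransport
import Summits.NavierStokesRegularity.NavierStokesRegularity.Theorems.PoloidalWindowDoorPoloidalWindowRigidityWindow
import Summits.NavierStokesRegularity.NavierStokesRegularity.Theorems.PoloidalWindowDoorPoloidalWindowRigidityLeafUniformVortexLine
import Summits.NavierStokesRegularity.NavierStokesRegularity.Theorems.PoloidalWindowDoorPoloidalWindowRigidityLeafUniformRidgeCore
import Summits.NavierStokesRegularity.NavierStokesRegularity.Theorems.PoloidalWindowDoorPoloidalWindowRigidityLeafUniformRidgeInvariant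
import Summits.NavierStokesRegularity.NavierStokesRegularity.Theorems.PoloidalWindowDoorPoloidalWindowRigidityLeafUniformCurtainCore

/-!
# Route `PoloidalWindowDoor`, crux `PoloidalWindowRigidity` (stmt-NavierStokesRegularity-19708) — LINE 18 «leaf_uniform»
# (ns-idea-8 g9, v1.3.1; critic idea-crit-7 g6 PASS; director-ns KEY-NS #190 (3): R8 → R16): support R16 `LeafGlobalLaw`,
# VERBATIM (Cruxes-local `Pinned` / `hotSet` / `lapH` / `hess` / `curtain` unfolded)

Seat ns-es-p1 g7 (free prover hand; CLAIM announced on the ideators / ns-regularity-ideate buses before proposing).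

* `leafGlobalLaw` (R16 `LeafGlobalLaw`): along a GLOBAL integral curve `γ : ℝ → ℝ³` of the time-`−1` vorticity `ω = curl v(−1,·)`
  of a pinned class profile with the frozen law, started at a hot point with `ω(γ 0) ≠ 0`:
  (a) every `γ τ` is hot (`(γ τ)₂ = 0`: `ω₂ ≡ 0`; `v₂(−1, γ τ) = N`: the frozen law `Dv₂(−1,·)[ω] ≡ 0`), `ω(γ τ) ≠ 0`
      (ODE uniqueness against the constant solution; the vorticity is globally Lipschitz by ns-poloidal-K2-p2 g13's
      `…LeafUniformVortexLine.curl_slice_bounded_lipschitz`, imported by name), and the RIDGE LAW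
      `Δₕv₂(γ τ)·‖ω(γ 0)‖² = Δₕv₂(γ 0)·‖ω(γ τ)‖²` (this seat's R8 `…LeafUniformRidgeInvariant.ridgeInvariant` on the arc
      `(−|τ|−1, |τ|+1)`, imported by name);
  (b) if `Δₕv₂(γ 0) ≠ 0` (MORSE; then `Δₕv₂ ≠ 0` along `γ` by (a)), the CURTAIN LAW `curtain(γ τ) = curtain(γ 0)`,
      `curtain = ∂₂₂v₂ − |∇ₕ∂₂v₂|²/Δₕv₂`: the pointwise transport identity `…LeafUniformCurtainCore.curtain_core`
      (frozen law differentiated twice, kernel relations `Hₕωₕ = 0`, `∇ₕ∂₂v₂ ⊥ ωₕ`, rank-one algebra) gives derivative `0`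
      at every `τ`, and `is_const_of_deriv_eq_zero` closes.  This is also the content of R11 `CurtainInvariant`
      (local-arc version), landed separately.

HONEST LABEL: ONE support stub (L) of a registered line; it closes no cell, no crux and no route item; the research cells
(MORSE/FLAT × ESCAPING/CAPTURED), C2a′ / C2b′ / S0, 19708 / 20428 and NS regularity stay OPEN — no summit statement is
proved here.
-/

noncomputable section

-- the summit and its single sub-problem share the name (CONVENTIONS §1), as in every Theorems file
set_option linter.dupNamespace false

namespace Summit.NavierStokesRegularity.NavierStokesRegularity.Theorems.PoloidalWindowDoorPoloidalWindowRigidityLeafUniformLeafGlobalLaw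

open Set Function Filter Topology Metric
open scoped InnerProductSpace RealInnerProductSpace Laplacian NNReal
open Literature.Analysis Literature.Analysis.FluidPDE
open Summit.NavierStokesRegularity.NavierStokesRegularity.Theorems.PoloidalWindowDoorPoloidalWindowRigidityWindow
open Summit.NavierStokesRegularity.NavierStokesRegularity.Theorems.PoloidalWindowDoorPoloidalWindowRigidityLeafUniformVortexLine
open Summit.NavierStokesRegularity.NavierStokesRegularity.Theorems.PoloidalWindowDoorPoloidalWindowRigidityLeafUniformRidgeCore
open Summit.NavierStokesRegularity.NavierStokesRegularity.Theorems.PoloidalWindowDoorPoloidalWindowRigidityLeafUniformRidgeInvariant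
open Summit.NavierStokesRegularity.NavierStokesRegularity.Theorems.PoloidalWindowDoorPoloidalWindowRigidityLeafUniformCurtainCore

/-! ## R16 — global leaf laws -/

/-- **R16 `LeafGlobalLaw` (VERBATIM, `Pinned` / `hotSet` / `lapH` / `hess` / `curtain` unfolded).**  See the module docstring:
(a) hotness, non-vanishing vorticity and the ridge law along the whole global vortex line; (b) the curtain law on Morse leaves. -/
theorem leafGlobalLaw :
    ∀ (C : ℝ) (v : ℝ → EuclideanSpace ℝ (Fin 3) → EuclideanSpace ℝ (Fin 3)),
      (Literature.Analysis.FluidPDE.HasTypeITimeDecay C v ∧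
        ContinuousOn (Function.uncurry v) (Set.Iio (0 : ℝ) ×ˢ Set.univ) ∧
        (∀ s t : ℝ, s < t → t < 0 → ∀ x, v t x =
          Literature.Analysis.UnboundedOperators.heatExtension (v s) (t - s) x -
            Literature.Analysis.FluidPDE.oseenDuhamel 1 s v v t x) ∧
        (∀ t < 0, Literature.Analysis.FluidPDE.VectorCalculus.IsDivFree (v t)) ∧
        (∀ s < 0, ∀ y, ⟪Literature.Analysis.FluidPDE.curl (v s) y, EuclideanSpace.single 2 1⟫_ℝ = 0) ∧
        v (-1) 0 2 ≠ 0 ∧ (∀ t < 0, ∀ x, Real.sqrt (-t) * |v t x 2| ≤ |v (-1) 0 2|) ∧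
        (∀ h : EuclideanSpace ℝ (Fin 3), fderiv ℝ (v (-1)) 0 h 2 = 0) ∧
        (deriv (fun s => v s 0 2) (-1) = v (-1) 0 2 / 2 ∧ v (-1) 0 2 * (Δ (fun y => v (-1) y 2)) 0 ≤ 0)) →
      (∀ s < 0, ∀ y, ⟪fderiv ℝ (v s) y (Literature.Analysis.FluidPDE.curl (v s) y), EuclideanSpace.single 2 1⟫_ℝ = 0) →
      (∀ y ∈ {y : EuclideanSpace ℝ (Fin 3) | y 2 = 0 ∧ v (-1) y 2 = v (-1) 0 2},
          fderiv ℝ (fun x => v (-1) x 2) y = 0) →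
      ∀ γ : ℝ → EuclideanSpace ℝ (Fin 3),
        (∀ τ : ℝ, HasDerivAt γ (Literature.Analysis.FluidPDE.curl (v (-1)) (γ τ)) τ) →
        γ 0 ∈ {y : EuclideanSpace ℝ (Fin 3) | y 2 = 0 ∧ v (-1) y 2 = v (-1) 0 2} →
        Literature.Analysis.FluidPDE.curl (v (-1)) (γ 0) ≠ 0 →
        (∀ τ : ℝ, γ τ ∈ {y : EuclideanSpace ℝ (Fin 3) | y 2 = 0 ∧ v (-1) y 2 = v (-1) 0 2} ∧
            Literature.Analysis.FluidPDE.curl (v (-1)) (γ τ) ≠ 0 ∧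
            (fderiv ℝ (fun x => fderiv ℝ (fun x' => v (-1) x' 2) x (EuclideanSpace.single 0 1)) (γ τ) (EuclideanSpace.single 0 1) +
              fderiv ℝ (fun x => fderiv ℝ (fun x' => v (-1) x' 2) x (EuclideanSpace.single 1 1)) (γ τ) (EuclideanSpace.single 1 1)) *
                ‖Literature.Analysis.FluidPDE.curl (v (-1)) (γ 0)‖ ^ 2 =
              (fderiv ℝ (fun x => fderiv ℝ (fun x' => v (-1) x' 2) x (EuclideanSpace.single 0 1)) (γ 0) (EuclideanSpace.single 0 1) +
              fderiv ℝ (fun x => fderiv ℝ (fun x' => v (-1) x' 2) x (EuclideanSpace.single 1 1)) (γ 0) (EuclideanSpace.single 1 1)) *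
                ‖Literature.Analysis.FluidPDE.curl (v (-1)) (γ τ)‖ ^ 2) ∧
        ((fderiv ℝ (fun x => fderiv ℝ (fun x' => v (-1) x' 2) x (EuclideanSpace.single 0 1)) (γ 0) (EuclideanSpace.single 0 1) +
              fderiv ℝ (fun x => fderiv ℝ (fun x' => v (-1) x' 2) x (EuclideanSpace.single 1 1)) (γ 0) (EuclideanSpace.single 1 1)) ≠ 0 →
          ∀ τ : ℝ,
            (fderiv ℝ (fun x => fderiv ℝ (fun x' => v (-1) x' 2) x (EuclideanSpace.single 2 1)) (γ τ) (EuclideanSpace.single 2 1) -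
            (fderiv ℝ (fun x => fderiv ℝ (fun x' => v (-1) x' 2) x (EuclideanSpace.single 2 1)) (γ τ) (EuclideanSpace.single 0 1) ^ 2 +
                fderiv ℝ (fun x => fderiv ℝ (fun x' => v (-1) x' 2) x (EuclideanSpace.single 2 1)) (γ τ) (EuclideanSpace.single 1 1) ^ 2) /
              (fderiv ℝ (fun x => fderiv ℝ (fun x' => v (-1) x' 2) x (EuclideanSpace.single 0 1)) (γ τ) (EuclideanSpace.single 0 1) +
              fderiv ℝ (fun x => fderiv ℝ (fun x' => v (-1) x' 2) x (EuclideanSpace.single 1 1)) (γ τ) (EuclideanSpace.single 1 1))) =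
            (fderiv ℝ (fun x => fderiv ℝ (fun x' => v (-1) x' 2) x (EuclideanSpace.single 2 1)) (γ 0) (EuclideanSpace.single 2 1) -
            (fderiv ℝ (fun x => fderiv ℝ (fun x' => v (-1) x' 2) x (EuclideanSpace.single 2 1)) (γ 0) (EuclideanSpace.single 0 1) ^ 2 +
                fderiv ℝ (fun x => fderiv ℝ (fun x' => v (-1) x' 2) x (EuclideanSpace.single 2 1)) (γ 0) (EuclideanSpace.single 1 1) ^ 2) /
              (fderiv ℝ (fun x => fderiv ℝ (fun x' => v (-1) x' 2) x (EuclideanSpace.single 0 1)) (γ 0) (EuclideanSpace.single 0 1) +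
              fderiv ℝ (fun x => fderiv ℝ (fun x' => v (-1) x' 2) x (EuclideanSpace.single 1 1)) (γ 0) (EuclideanSpace.single 1 1)))) := by
  intro C v hP hfrozen hcritH γ hγ hγ0 hω0
  have hP' := hP
  obtain ⟨hTI, hcont, hmild, hdiv, hpol, -, -, -, -⟩ := hP'
  -- smoothness of the slice, of `w = v₂(−1,·)` and of `ω = curl v(−1,·)`
  have hclass : IsTypeIAncientMild C v := isTypeIAncientMild_of_class hTI hcont hmild hdiv
  have hvinf : ContDiff ℝ ((⊤ : ℕ∞) : WithTop ℕ∞) (v (-1)) := hclass.contDiff_slice (by norm_num)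
  have hsm : ∀ n : ℕ, ContDiff ℝ n (v (-1)) := fun n => contDiff_infty.1 hvinf n
  have hvd : ∀ x, DifferentiableAt ℝ (v (-1)) x := fun x => ((hsm 1).differentiable one_ne_zero) x
  have hw : ∀ n : ℕ, ContDiff ℝ n (fun x' => v (-1) x' 2) := fun n => contDiff_euclidean.1 (hsm n) 2
  have hwd : ∀ x, DifferentiableAt ℝ (fun x' => v (-1) x' 2) x := fun x => ((hw 1).differentiable one_ne_zero) x
  have hωinf : ContDiff ℝ ((⊤ : ℕ∞) : WithTop ℕ∞) (curl (v (-1))) := by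
    rw [curl_eq_curlCLM_comp]
    exact curlCLM.contDiff.comp (contDiff_infty_iff_fderiv.1 hvinf).2
  have hωs : ∀ n : ℕ, ContDiff ℝ n (curl (v (-1))) := fun n => contDiff_infty.1 hωinf n
  have hPs : ∀ (j : Fin 3) (n : ℕ), ContDiff ℝ n
      ((fun j : Fin 3 => fun x => fderiv ℝ (fun x' => v (-1) x' 2) x (EuclideanSpace.single j 1)) j) :=
    fun j n => contDiff_fderiv_apply_dir (n := n) (by exact_mod_cast hw (n + 1)) _
  -- `ω₂ ≡ 0` (poloidal) and the frozen law
  have hω2 : ∀ x, curl (v (-1)) x 2 = 0 := fun x => by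
    have h := hpol (-1) (by norm_num) x
    rw [EuclideanSpace.inner_single_right] at h
    simpa using h
  have hfro' : ∀ x, fderiv ℝ (fun x' => v (-1) x' 2) x (curl (v (-1)) x) = 0 := fun x => by
    have h := hfrozen (-1) (by norm_num) x
    rw [EuclideanSpace.inner_single_right] at h
    have h' : fderiv ℝ (v (-1)) x (curl (v (-1)) x) 2 = 0 := by simpa using h
    rwa [fderiv_apply_coord (hvd x)] at h'
  have hFro : ∀ x, curl (v (-1)) x 0 * fderiv ℝ (fun x' => v (-1) x' 2) x (EuclideanSpace.single 0 1) +
      curl (v (-1)) x 1 * fderiv ℝ (fun x' => v (-1) x' 2) x (EuclideanSpace.single 1 1) = 0 := fun x => by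
    have h' := hfro' x
    rw [clm_apply_eq_sum_three, hω2 x, zero_mul, add_zero] at h'
    exact h'
  -- (a1) every point of the leaf is hot: two first integrals
  have hz : ∀ τ, γ τ 2 = 0 := by
    have hd : ∀ τ, HasDerivAt (fun s => γ s 2) 0 τ := fun τ => by
      have h := ((EuclideanSpace.proj (2 : Fin 3) : EuclideanSpace ℝ (Fin 3) →L[ℝ] ℝ).hasFDerivAt.comp_hasDerivAt
        τ (hγ τ))
      have hval : (EuclideanSpace.proj (2 : Fin 3) : EuclideanSpace ℝ (Fin 3) →L[ℝ] ℝ) (curl (v (-1)) (γ τ)) = 0 := hω2 _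
      rw [hval] at h
      exact h
    intro τ
    have hc := is_const_of_deriv_eq_zero (fun τ => (hd τ).differentiableAt) (fun τ => (hd τ).deriv) τ 0
    have h0 : γ 0 2 = 0 := hγ0.1
    simp only at hc
    rw [hc]; exact h0
  have hN : ∀ τ, v (-1) (γ τ) 2 = v (-1) 0 2 := by
    have hd : ∀ τ, HasDerivAt (fun s => v (-1) (γ s) 2) 0 τ := fun τ => by
      have h := hasDerivAt_comp_curve (φ := (fun x' => v (-1) x' 2)) (hwd _) (hγ τ)
      rw [hfro'] at h
      exact h
    intro τ
    have hc := is_const_of_deriv_eq_zero (fun τ => (hd τ).differentiableAt) (fun τ => (hd τ).deriv) τ 0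
    simp only at hc
    rw [hc]; exact hγ0.2
  have hhot : ∀ τ, γ τ ∈ {y : EuclideanSpace ℝ (Fin 3) | y 2 = 0 ∧ v (-1) y 2 = v (-1) 0 2} := fun τ => ⟨hz τ, hN τ⟩
  -- (a2) the vorticity never vanishes along the leaf
  have hne : ∀ τ, curl (v (-1)) (γ τ) ≠ 0 := by
    intro τ hzero
    obtain ⟨K, L, hK, -⟩ := curl_slice_bounded_lipschitz hTI hcont hmild hdiv (s := -1) (by norm_num)
    have huniq := ODE_solution_unique_univ (v := fun _ => curl (v (-1))) (s := fun _ => (univ : Set _))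
      (K := K) (f := γ) (g := fun _ => γ τ) (t₀ := τ) (fun _ => hK.lipschitzOnWith)
      (fun s => ⟨hγ s, mem_univ _⟩)
      (fun s => ⟨by rw [hzero]; exact hasDerivAt_const s (γ τ), mem_univ _⟩) rfl
    exact hω0 (by rw [congrFun huniq 0]; exact hzero)
  -- (a3) the ridge law along the leaf: R8 on the arc `(−|τ|−1, |τ|+1)`
  have hridge : ∀ τ : ℝ,
      (fderiv ℝ (fun x => fderiv ℝ (fun x' => v (-1) x' 2) x (EuclideanSpace.single 0 1)) (γ τ) (EuclideanSpace.single 0 1) +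
              fderiv ℝ (fun x => fderiv ℝ (fun x' => v (-1) x' 2) x (EuclideanSpace.single 1 1)) (γ τ) (EuclideanSpace.single 1 1)) *
          ‖curl (v (-1)) (γ 0)‖ ^ 2 =
        (fderiv ℝ (fun x => fderiv ℝ (fun x' => v (-1) x' 2) x (EuclideanSpace.single 0 1)) (γ 0) (EuclideanSpace.single 0 1) +
              fderiv ℝ (fun x => fderiv ℝ (fun x' => v (-1) x' 2) x (EuclideanSpace.single 1 1)) (γ 0) (EuclideanSpace.single 1 1)) *
          ‖curl (v (-1)) (γ τ)‖ ^ 2 := fun τ =>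
    ridgeInvariant C v hP hfrozen γ (|τ| + 1)
      ⟨by positivity, hhot 0, hω0, fun s _ => ⟨hγ s, hhot s⟩⟩ τ
      ⟨by linarith [neg_abs_le τ], by linarith [le_abs_self τ]⟩
  refine ⟨fun τ => ⟨hhot τ, hne τ, hridge τ⟩, fun hL0 τ => ?_⟩
  -- (b) the curtain law
  have hLne : ∀ s : ℝ, (fderiv ℝ (fun x => fderiv ℝ (fun x' => v (-1) x' 2) x (EuclideanSpace.single 0 1)) (γ s) (EuclideanSpace.single 0 1) +
              fderiv ℝ (fun x => fderiv ℝ (fun x' => v (-1) x' 2) x (EuclideanSpace.single 1 1)) (γ s) (EuclideanSpace.single 1 1)) ≠ 0 := by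
    intro s hs
    have h := hridge s
    rw [hs, zero_mul] at h
    exact mul_ne_zero hL0 (pow_ne_zero 2 (norm_ne_zero_iff.2 (hne s))) h.symm
  have hSch : ∀ (i j : Fin 3) (x : EuclideanSpace ℝ (Fin 3)),
      fderiv ℝ ((fun j : Fin 3 => fun x => fderiv ℝ (fun x' => v (-1) x' 2) x (EuclideanSpace.single j 1)) j) x
          (EuclideanSpace.single i 1) =
        fderiv ℝ ((fun j : Fin 3 => fun x => fderiv ℝ (fun x' => v (-1) x' 2) x (EuclideanSpace.single j 1)) i) x
          (EuclideanSpace.single j 1) :=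
    fun i j x => fderiv_dir_comm (hw 2).contDiffAt _ _
  have hzero : ∀ (j : Fin 3), ∀ s ∈ Ioo (-(|τ| + 1)) (|τ| + 1),
      ((fun j : Fin 3 => fun x => fderiv ℝ (fun x' => v (-1) x' 2) x (EuclideanSpace.single j 1)) j) (γ s) = 0 := by
    intro j s _
    show fderiv ℝ (fun x' => v (-1) x' 2) (γ s) (EuclideanSpace.single j 1) = 0
    rw [hcritH (γ s) (hhot s)]
    rfl
  have hd : ∀ s : ℝ, HasDerivAt (fun s =>
      (fderiv ℝ (fun x => fderiv ℝ (fun x' => v (-1) x' 2) x (EuclideanSpace.single 2 1)) (γ s) (EuclideanSpace.single 2 1) -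
            (fderiv ℝ (fun x => fderiv ℝ (fun x' => v (-1) x' 2) x (EuclideanSpace.single 2 1)) (γ s) (EuclideanSpace.single 0 1) ^ 2 +
                fderiv ℝ (fun x => fderiv ℝ (fun x' => v (-1) x' 2) x (EuclideanSpace.single 2 1)) (γ s) (EuclideanSpace.single 1 1) ^ 2) /
              (fderiv ℝ (fun x => fderiv ℝ (fun x' => v (-1) x' 2) x (EuclideanSpace.single 0 1)) (γ s) (EuclideanSpace.single 0 1) +
              fderiv ℝ (fun x => fderiv ℝ (fun x' => v (-1) x' 2) x (EuclideanSpace.single 1 1)) (γ s) (EuclideanSpace.single 1 1)))) 0 s := by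
    intro s
    exact curtain_core (P := fun j : Fin 3 => fun x => fderiv ℝ (fun x' => v (-1) x' 2) x (EuclideanSpace.single j 1))
      (ε := |s| + 1) hPs hωs hSch hFro hω2
      (by
        intro j r _
        show fderiv ℝ (fun x' => v (-1) x' 2) (γ r) (EuclideanSpace.single j 1) = 0
        rw [hcritH (γ r) (hhot r)]
        rfl)
      (fun r _ => hγ r) ⟨by linarith [neg_abs_le s], by linarith [le_abs_self s]⟩ (hLne s) (hne s)
  have hc := is_const_of_deriv_eq_zero (fun s => (hd s).differentiableAt) (fun s => (hd s).deriv) τ 0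
  exact hc

end Summit.NavierStokesRegularity.NavierStokesRegularity.Theorems.PoloidalWindowDoorPoloidalWindowRigidityLeafUniformLeafGlobalLaw

end
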